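/-
Copyright (c) 2026 the pub-hodgecm-mathlib formalisation cell (harness21).  Prover seat hodgecm-mathlib-LH7-p07 (g2) on the CHAIR K2-lead VALVE,
Track B «K2-LIT» ∕ hLiu418 #184♮ = `stmt-HodgeConjecture-24832`, Road I v3 U5 «THE CLOSE» — FACE-G organ (G-gen) = F4, road (E), brick (E-b)
(LEAD F0P6-plan (g14) BATCH #113 (2)(b); F4 lead K2Liu-p27 (g2) ROAD VERDICT (E) 2026-09-04T23:03:11Z; desk K2Liu-p10 (g6)).  THEOREMS ONLY.
-/
import Literature.RepresentationTheory.KonnoKonno2007.JunctionPMinusFockSymbol   -- ★ `pairSymbW`, `hypOpGen_{add,sub}_I_smul_rotBoostGen_binvPi` (the `𝔭^∓` Fock symbols), `DPIdx`, `binvPi`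
import HarnessLib

/-!
# Crux `HLiu418`, FACE-G organ (G-gen), road (E) brick (E-b): THE FOCK `𝔭`-ACTION LETTERS — contractions `C`, Laplacians `D`, polarisations `E`
# on the junction Fock ring `ℂ[z_v : v ∈ DPIdx P Q R S]`, their commutators, `D·1 = 0`, and the bridge to the ★ `𝔭^±` symbols

Cell `hodgecm-mathlib`, crux item hLiu418 = `stmt-HodgeConjecture-24832`; squad K2 ∕ K2Liu, FACE-G F4 lead K2Liu-p27 (g2), desk K2Liu-p10 (g6);
prover LH7-p07 (g2).  THEOREMS ONLY (no `def`, no instance, no notation, no named-fact hypothesis, no `sorry`); lane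
`--supports stmt-HodgeConjecture-24832 --as helper` (count-neutral).

SETTING.  The junction Fock model of the real dual pair `(U(P,Q), U(R,S))` (★ Konno–Konno `RealDualPair`; `U(2,2) × U(p,q)` is `P = Q = Fin 2`) is the ring
`ℂ[z_v]`, `v ∈ DPIdx P Q R S = ((P × R) ⊕ (Q × S)) ⊕ ((P × S) ⊕ (Q × R))`, read on Schwartz space through `B⁻¹ = binvPi`; by ★ `hypOpGen_sub_I_smul_rotBoostGen_binvPi`
∕ `…_add_…` the complexified boost letters `𝔭^±_{(p,q)}` (`p ∈ P`, `q ∈ Q`) act on `B⁻¹F` through four operator families per plane type `T ∈ {R, S}` (`z_{(p,t)}` the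
`P`-row «vector», `z_{(q,t)}` the `Q`-row «covector» variables): CONTRACTIONS `C^T_{kl} = Σ_t z_{(k,t)} z_{(l,t)}` (multipliers; four per `T` at `P = Q = Fin 2`),
LAPLACIANS `D^T_{ij} = Σ_t ∂_{(i,t)}∂_{(j,t)}`, POLARISATIONS `E^{P,T}_{ki} = Σ_t z_{(k,t)}∂_{(i,t)}`, `E^{Q,T}_{lj} = Σ_t z_{(l,t)}∂_{(j,t)}` (the degree operators).
§1 is stated ONCE, generically, for jointly injective index families `x : P → T → σ`, `y : Q → T → σ` with disjoint ranges (serving the `R`-planes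
`x p r = inl (inl (p,r))`, `y q r = inr (inr (q,r))` and the `S`-planes `x p s = inr (inl (p,s))`, `y q s = inl (inr (q,s))` alike, §2):
* §1 LETTERS: `D·1 = 0`, `E·1 = 0` (`lap_one`, `polFst_one`, `polSnd_one`); `pderiv_fst_contr` ∕ `pderiv_snd_contr`; **`lap_contr_mul`** — `D_{ij}(C_{kl}·F) =
  C_{kl}·D_{ij}F + [j = l]·E^P_{ki}F + [i = k]·E^Q_{lj}F + [i = k ∧ j = l]·|T|·F` («`[D, C]` = degree operators + constants»); **`polFst_contr_mul`** — `E^P_{ki}(C_{ab}·F) =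
  C_{ab}·E^P_{ki}F + [i = a]·C_{kb}·F`; **`polSnd_contr_mul`** — `E^Q_{lj}(C_{ab}·F) = C_{ab}·E^Q_{lj}F + [j = b]·C_{al}·F`; `lap_contr` (`D_{ij}C_{kl} = [i = k ∧ j = l]·|T|`);
  the DISJOINT-VARIABLE rule `lap_mul_of_const` ∕ `polFst_mul_of_const` ∕ `polSnd_mul_of_const` (an operator passes through any multiplier its derivatives kill).
* §2 the `DPIdx` INSTANCES (`lapS_contrS_mul`, `lapR_contrR_mul`, `lapS_contrR_mul`, `lapR_contrS_mul`, …) and **THE BRIDGE** `pPlus_binvPi` ∕ `pMinus_binvPi`: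
  `𝔭⁺_{(p,q)}(B⁻¹F) = B⁻¹((2i∕π)·D^S_{pq}F − 2πi·C^R_{pq}·F)`, `𝔭⁻_{(p,q)}(B⁻¹F) = B⁻¹(2πi·C^S_{pq}·F − (2i∕π)·D^R_{pq}F)` with the contraction as ONE multiplier, so
  every word in `𝔭^±` on `𝒫·Gauss` is a word in `C, D` on `𝒫`; on the vacuum polynomial: `pPlus_binvPi_one`, `pMinus_binvPi_one` (pure creation).
CONSUMERS: (E-c) `K2LiuFockPBWInduction` (K2Liu-p27: the words in these operators applied to `1` span every balanced product `(∏ C^R)(∏ C^S)`); (E-e) (LH7-p05).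
References: [Folland1989] G. B. Folland, *Harmonic Analysis in Phase Space* (1989) §4.2 Prop. (4.39), §4.5; [KashiwaraVergne1978] M. Kashiwara, M. Vergne,
Invent. Math. 44 (1978) §II.5 (the `𝔭^±` parts act by `zz′` ∕ `∂∂′`, the `𝔨`-part by polarisations); [Howe1989Remarks] R. Howe, Trans. AMS 313 (1989) §2–§3.
HONEST LABEL.  Count-neutral helper: `HC_CM` is proved only modulo the 7 printed citations (2 remaining named inputs: hLiu418 = `stmt-HodgeConjecture-24832`,
h413 = `stmt-HodgeConjecture-24833`) until rung 0 closes; this file closes no socket.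
-/

set_option autoImplicit false
set_option linter.dupNamespace false -- the mandated namespace repeats `HodgeConjecture.HodgeConjecture`

noncomputable section

open MvPolynomial Complex
open scoped Real
open Literature.Analysis.SegalBargmann
open Literature.RepresentationTheory.KonnoKonno2007.RealDualPair

namespace Summit.HodgeConjecture.HodgeConjecture.Cruxes.HLiu418.K2LiuFockPActionLetters

/-! ## §1 The two-row contraction calculus, generic in the index families -/

section Generic

variable {σ : Type*} {P Q T : Type*} (x : P → T → σ) (y : Q → T → σ)

/-- `∂_v z_w = [w = v]`. [folklore] -/
theorem pderiv_X_ite [DecidableEq σ] (v w : σ) : pderiv v (X w : MvPolynomial σ ℂ) = if w = v then 1 else 0 := by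
  by_cases h : w = v
  · rw [if_pos h, h, pderiv_X_self]
  · rw [if_neg h, pderiv_X_of_ne h]

/-- **DISJOINT-VARIABLE RULE**: a derivation that kills `c` passes through multiplication by `c`: `∂_v(c·F) = c·∂_v F`. [folklore] -/
theorem pderiv_mul_of_pderiv_eq_zero (v : σ) {c : MvPolynomial σ ℂ} (hc : pderiv v c = 0) (F : MvPolynomial σ ℂ) :
    pderiv v (c * F) = c * pderiv v F := by
  rw [pderiv_mul, hc, zero_mul, zero_add]

/-- `D_{ij}(c·F) = c·D_{ij}F` whenever the `x`- and `y`-row derivatives kill `c` (e.g. `c` a contraction of the OTHER plane type). [folklore] -/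
theorem lap_mul_of_const [Fintype T] (i : P) (j : Q) {c : MvPolynomial σ ℂ} (hcx : ∀ t, pderiv (x i t) c = 0)
    (hcy : ∀ t, pderiv (y j t) c = 0) (F : MvPolynomial σ ℂ) :
    ∑ t, pderiv (x i t) (pderiv (y j t) (c * F)) = c * ∑ t, pderiv (x i t) (pderiv (y j t) F) := by
  rw [Finset.mul_sum]
  exact Finset.sum_congr rfl fun t _ => by rw [pderiv_mul_of_pderiv_eq_zero _ (hcy t), pderiv_mul_of_pderiv_eq_zero _ (hcx t)]

/-- `E^P_{ki}(c·F) = c·E^P_{ki}F` whenever the `x`-row derivatives kill `c`. [folklore] -/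
theorem polFst_mul_of_const [Fintype T] (k i : P) {c : MvPolynomial σ ℂ} (hcx : ∀ t, pderiv (x i t) c = 0) (F : MvPolynomial σ ℂ) :
    ∑ t, X (x k t) * pderiv (x i t) (c * F) = c * ∑ t, X (x k t) * pderiv (x i t) F := by
  rw [Finset.mul_sum]
  exact Finset.sum_congr rfl fun t _ => by rw [pderiv_mul_of_pderiv_eq_zero _ (hcx t)]; ring

/-- `E^Q_{lj}(c·F) = c·E^Q_{lj}F` whenever the `y`-row derivatives kill `c`. [folklore] -/
theorem polSnd_mul_of_const [Fintype T] (l j : Q) {c : MvPolynomial σ ℂ} (hcy : ∀ t, pderiv (y j t) c = 0) (F : MvPolynomial σ ℂ) :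
    ∑ t, X (y l t) * pderiv (y j t) (c * F) = c * ∑ t, X (y l t) * pderiv (y j t) F := by
  rw [Finset.mul_sum]
  exact Finset.sum_congr rfl fun t _ => by rw [pderiv_mul_of_pderiv_eq_zero _ (hcy t)]; ring

/-- **`D·1 = 0`**. [cite: Folland1989, §4.2 Prop. (4.39)] -/
theorem lap_one [Fintype T] (i : P) (j : Q) : ∑ t, pderiv (x i t) (pderiv (y j t) (1 : MvPolynomial σ ℂ)) = 0 :=
  Finset.sum_eq_zero fun t _ => by rw [pderiv_one, map_zero]

/-- `D z_w = 0` (Laplacians kill degree one). [cite: Folland1989, §4.2 Prop. (4.39)] -/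
theorem lap_X [Fintype T] [DecidableEq σ] (i : P) (j : Q) (w : σ) : ∑ t, pderiv (x i t) (pderiv (y j t) (X w : MvPolynomial σ ℂ)) = 0 :=
  Finset.sum_eq_zero fun t _ => by
    rw [pderiv_X_ite]
    split_ifs
    · exact pderiv_one
    · exact map_zero _

/-- **`E^P·1 = 0`**. [folklore] -/
theorem polFst_one [Fintype T] (k i : P) : ∑ t, X (x k t) * pderiv (x i t) (1 : MvPolynomial σ ℂ) = 0 :=
  Finset.sum_eq_zero fun t _ => by rw [pderiv_one, mul_zero]

/-- **`E^Q·1 = 0`**. [folklore] -/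
theorem polSnd_one [Fintype T] (l j : Q) : ∑ t, X (y l t) * pderiv (y j t) (1 : MvPolynomial σ ℂ) = 0 :=
  Finset.sum_eq_zero fun t _ => by rw [pderiv_one, mul_zero]

/-- the `y`-derivatives kill the `x`-variables (disjoint ranges `hxy`). [folklore] -/
theorem pderiv_snd_X_fst (hxy : ∀ i j t t', x i t ≠ y j t') (j : Q) (t : T) (k : P) (t' : T) :
    pderiv (y j t) (X (x k t') : MvPolynomial σ ℂ) = 0 :=
  pderiv_X_of_ne (hxy k j t' t)

/-- the `x`-derivatives kill the `y`-variables. [folklore] -/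
theorem pderiv_fst_X_snd (hxy : ∀ i j t t', x i t ≠ y j t') (i : P) (t : T) (l : Q) (t' : T) :
    pderiv (x i t) (X (y l t') : MvPolynomial σ ℂ) = 0 :=
  pderiv_X_of_ne fun h => hxy i l t t' h.symm

/-- `∂_{(i,t)} z_{(k,t′)} = [i = k ∧ t = t′]` on the `x`-row (joint injectivity `hx`). [folklore] -/
theorem pderiv_fst_X_fst [DecidableEq σ] [DecidableEq P] [DecidableEq T] (hx : ∀ i k t t', x i t = x k t' ↔ i = k ∧ t = t')
    (i : P) (t : T) (k : P) (t' : T) :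
    pderiv (x i t) (X (x k t') : MvPolynomial σ ℂ) = if i = k ∧ t = t' then 1 else 0 := by
  rw [pderiv_X_ite]
  by_cases h : i = k ∧ t = t'
  · rw [if_pos h, if_pos ((hx k i t' t).2 ⟨h.1.symm, h.2.symm⟩)]
  · rw [if_neg h, if_neg fun h' => h (let h'' := (hx k i t' t).1 h'; ⟨h''.1.symm, h''.2.symm⟩)]

/-- `∂_{(j,t)} z_{(l,t′)} = [j = l ∧ t = t′]` on the `y`-row (joint injectivity `hy`). [folklore] -/
theorem pderiv_snd_X_snd [DecidableEq σ] [DecidableEq Q] [DecidableEq T] (hy : ∀ j l t t', y j t = y l t' ↔ j = l ∧ t = t')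
    (j : Q) (t : T) (l : Q) (t' : T) :
    pderiv (y j t) (X (y l t') : MvPolynomial σ ℂ) = if j = l ∧ t = t' then 1 else 0 := by
  rw [pderiv_X_ite]
  by_cases h : j = l ∧ t = t'
  · rw [if_pos h, if_pos ((hy l j t' t).2 ⟨h.1.symm, h.2.symm⟩)]
  · rw [if_neg h, if_neg fun h' => h (let h'' := (hy l j t' t).1 h'; ⟨h''.1.symm, h''.2.symm⟩)]

section Inj

variable [Fintype T] [DecidableEq σ] [DecidableEq T]
  (hx : ∀ i k t t', x i t = x k t' ↔ i = k ∧ t = t') (hy : ∀ j l t t', y j t = y l t' ↔ j = l ∧ t = t')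
  (hxy : ∀ i j t t', x i t ≠ y j t')

include hy hxy in
/-- **the `Q`-row derivative of a contraction**: `∂_{(j,t)} C_{kl} = [j = l]·z_{(k,t)}`. [cite: KashiwaraVergne1978, §II.5] -/
theorem pderiv_snd_contr [DecidableEq Q] (j : Q) (t : T) (k : P) (l : Q) :
    pderiv (y j t) (∑ t', X (x k t') * X (y l t') : MvPolynomial σ ℂ) = if j = l then X (x k t) else 0 := by
  rw [map_sum]
  have h : ∀ t', pderiv (y j t) (X (x k t') * X (y l t') : MvPolynomial σ ℂ) = if j = l ∧ t = t' then X (x k t') else 0 := fun t' => by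
    rw [pderiv_mul, pderiv_snd_X_fst x y hxy, zero_mul, zero_add, pderiv_snd_X_snd y hy]
    split_ifs <;> simp
  simp_rw [h]
  by_cases hjl : j = l
  · simp only [hjl, true_and, Finset.sum_ite_eq, Finset.mem_univ, if_true]
  · simp only [hjl, false_and, if_false, Finset.sum_const_zero]

include hx hxy in
/-- **the `P`-row derivative of a contraction**: `∂_{(i,t)} C_{kl} = [i = k]·z_{(l,t)}`. [cite: KashiwaraVergne1978, §II.5] -/
theorem pderiv_fst_contr [DecidableEq P] (i : P) (t : T) (k : P) (l : Q) :
    pderiv (x i t) (∑ t', X (x k t') * X (y l t') : MvPolynomial σ ℂ) = if i = k then X (y l t) else 0 := by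
  rw [map_sum]
  have h : ∀ t', pderiv (x i t) (X (x k t') * X (y l t') : MvPolynomial σ ℂ) = if i = k ∧ t = t' then X (y l t') else 0 := fun t' => by
    rw [pderiv_mul, pderiv_fst_X_snd x y hxy, mul_zero, add_zero, pderiv_fst_X_fst x hx]
    split_ifs <;> simp
  simp_rw [h]
  by_cases hik : i = k
  · simp only [hik, true_and, Finset.sum_ite_eq, Finset.mem_univ, if_true]
  · simp only [hik, false_and, if_false, Finset.sum_const_zero]

include hx hxy in
/-- **`[E^P, C]`**: `E^P_{ki}(C_{ab}·F) = C_{ab}·E^P_{ki}F + [i = a]·C_{kb}·F`. [cite: KashiwaraVergne1978, §II.5] [cite: Howe1989Remarks, §2] -/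
theorem polFst_contr_mul [DecidableEq P] (k i a : P) (b : Q) (F : MvPolynomial σ ℂ) :
    ∑ t, X (x k t) * pderiv (x i t) ((∑ t', X (x a t') * X (y b t')) * F) =
      (∑ t', X (x a t') * X (y b t')) * (∑ t, X (x k t) * pderiv (x i t) F) +
        if i = a then (∑ t, X (x k t) * X (y b t)) * F else 0 := by
  simp_rw [pderiv_mul, pderiv_fst_contr x y hx hxy]
  have h : ∀ t, X (x k t) * ((if i = a then X (y b t) else 0) * F + (∑ t', X (x a t') * X (y b t')) * pderiv (x i t) F) =
      (∑ t', X (x a t') * X (y b t')) * (X (x k t) * pderiv (x i t) F) + (if i = a then X (x k t) * X (y b t) * F else 0) := fun t => by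
    split_ifs <;> ring
  simp_rw [h]
  rw [Finset.sum_add_distrib, ← Finset.mul_sum, Finset.sum_ite_irrel, Finset.sum_const_zero, ← Finset.sum_mul]

include hy hxy in
/-- **`[E^Q, C]`**: `E^Q_{lj}(C_{ab}·F) = C_{ab}·E^Q_{lj}F + [j = b]·C_{al}·F`. [cite: KashiwaraVergne1978, §II.5] [cite: Howe1989Remarks, §2] -/
theorem polSnd_contr_mul [DecidableEq Q] (l j : Q) (a : P) (b : Q) (F : MvPolynomial σ ℂ) :
    ∑ t, X (y l t) * pderiv (y j t) ((∑ t', X (x a t') * X (y b t')) * F) =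
      (∑ t', X (x a t') * X (y b t')) * (∑ t, X (y l t) * pderiv (y j t) F) +
        if j = b then (∑ t, X (x a t) * X (y l t)) * F else 0 := by
  simp_rw [pderiv_mul, pderiv_snd_contr x y hy hxy]
  have h : ∀ t, X (y l t) * ((if j = b then X (x a t) else 0) * F + (∑ t', X (x a t') * X (y b t')) * pderiv (y j t) F) =
      (∑ t', X (x a t') * X (y b t')) * (X (y l t) * pderiv (y j t) F) + (if j = b then X (x a t) * X (y l t) * F else 0) := fun t => by
    split_ifs <;> ring
  simp_rw [h]
  rw [Finset.sum_add_distrib, ← Finset.mul_sum, Finset.sum_ite_irrel, Finset.sum_const_zero, ← Finset.sum_mul]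

include hx hy hxy in
/-- the summand of `[D, C]`: `∂_{(i,t)}∂_{(j,t)}(C_{kl}·F) = C_{kl}·∂∂F + [j = l]·z_{(k,t)}∂_{(i,t)}F + [i = k]·z_{(l,t)}∂_{(j,t)}F + [i = k ∧ j = l]·F`.
[cite: KashiwaraVergne1978, §II.5] -/
theorem lap_summand_contr_mul [DecidableEq P] [DecidableEq Q] (i : P) (j : Q) (t : T) (k : P) (l : Q) (F : MvPolynomial σ ℂ) :
    pderiv (x i t) (pderiv (y j t) ((∑ t', X (x k t') * X (y l t')) * F)) =
      (∑ t', X (x k t') * X (y l t')) * pderiv (x i t) (pderiv (y j t) F) +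
        (if j = l then X (x k t) * pderiv (x i t) F else 0) + (if i = k then X (y l t) * pderiv (y j t) F else 0) +
          (if i = k ∧ j = l then F else 0) := by
  have h1 : pderiv (x i t) (if j = l then X (x k t) else 0 : MvPolynomial σ ℂ) = if i = k ∧ j = l then 1 else 0 := by
    by_cases hjl : j = l
    · rw [if_pos hjl, pderiv_fst_X_fst x hx]
      by_cases hik : i = k
      · rw [if_pos ⟨hik, rfl⟩, if_pos ⟨hik, hjl⟩]
      · rw [if_neg fun h => hik h.1, if_neg fun h => hik h.1]
    · rw [if_neg hjl, map_zero, if_neg fun h => hjl h.2]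
  rw [pderiv_mul, map_add, pderiv_mul, pderiv_mul, pderiv_snd_contr x y hy hxy, pderiv_fst_contr x y hx hxy, h1]
  simp only [ite_mul, zero_mul, one_mul]
  abel

include hx hy hxy in
/-- **`[D, C]` = DEGREE OPERATORS + CONSTANTS**:
`D_{ij}(C_{kl}·F) = C_{kl}·D_{ij}F + [j = l]·E^P_{ki}F + [i = k]·E^Q_{lj}F + [i = k ∧ j = l]·|T|·F`. [cite: KashiwaraVergne1978, §II.5] [cite: Howe1989Remarks, §2]
[cite: Folland1989, §4.5] -/
theorem lap_contr_mul [DecidableEq P] [DecidableEq Q] (i : P) (j : Q) (k : P) (l : Q) (F : MvPolynomial σ ℂ) :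
    ∑ t, pderiv (x i t) (pderiv (y j t) ((∑ t', X (x k t') * X (y l t')) * F)) =
      (∑ t', X (x k t') * X (y l t')) * (∑ t, pderiv (x i t) (pderiv (y j t) F)) +
        (if j = l then ∑ t, X (x k t) * pderiv (x i t) F else 0) + (if i = k then ∑ t, X (y l t) * pderiv (y j t) F else 0) +
          (if i = k ∧ j = l then (Fintype.card T : ℂ) • F else 0) := by
  simp_rw [lap_summand_contr_mul x y hx hy hxy]
  simp only [Finset.sum_add_distrib, Finset.sum_ite_irrel, Finset.sum_const_zero, Finset.mul_sum, Finset.sum_const, Finset.card_univ]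
  rw [Nat.cast_smul_eq_nsmul]

include hx hy hxy in
/-- **`D_{ij} C_{kl} = [i = k ∧ j = l]·|T|`** on the bare contraction. [cite: KashiwaraVergne1978, §II.5] -/
theorem lap_contr [DecidableEq P] [DecidableEq Q] (i : P) (j : Q) (k : P) (l : Q) :
    ∑ t, pderiv (x i t) (pderiv (y j t) (∑ t', X (x k t') * X (y l t') : MvPolynomial σ ℂ)) =
      if i = k ∧ j = l then (Fintype.card T : ℂ) • (1 : MvPolynomial σ ℂ) else 0 := by
  have h := lap_contr_mul x y hx hy hxy i j k l 1
  rw [mul_one] at h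
  rw [h, lap_one, polFst_one, polSnd_one, mul_zero, zero_add]
  simp only [ite_self, add_zero, zero_add]

end Inj

end Generic

/-! ## §2 The `DPIdx` instances and the bridge to the ★ `𝔭^±` symbols -/

section Junction

variable {P Q : Type*} (R S : Type*)

/-- joint injectivity of the `P × R` coordinates `z_{(p,r)} = inl (inl (p,r))`. [folklore] -/
theorem xR_inj (i k : P) (t t' : R) :
    (Sum.inl (Sum.inl (i, t)) : DPIdx P Q R S) = Sum.inl (Sum.inl (k, t')) ↔ i = k ∧ t = t' := by
  simp only [Sum.inl.injEq, Prod.mk.injEq]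

/-- joint injectivity of the `Q × R` coordinates `z_{(q,r)} = inr (inr (q,r))`. [folklore] -/
theorem yR_inj (j l : Q) (t t' : R) :
    (Sum.inr (Sum.inr (j, t)) : DPIdx P Q R S) = Sum.inr (Sum.inr (l, t')) ↔ j = l ∧ t = t' := by
  simp only [Sum.inr.injEq, Prod.mk.injEq]

/-- the `P × R` and `Q × R` coordinates are distinct. [folklore] -/
theorem xR_ne_yR (i : P) (j : Q) (t t' : R) : (Sum.inl (Sum.inl (i, t)) : DPIdx P Q R S) ≠ Sum.inr (Sum.inr (j, t')) :=
  Sum.inl_ne_inr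

/-- joint injectivity of the `P × S` coordinates `z_{(p,s)} = inr (inl (p,s))`. [folklore] -/
theorem xS_inj (i k : P) (t t' : S) :
    (Sum.inr (Sum.inl (i, t)) : DPIdx P Q R S) = Sum.inr (Sum.inl (k, t')) ↔ i = k ∧ t = t' := by
  simp only [Sum.inr.injEq, Sum.inl.injEq, Prod.mk.injEq]

/-- joint injectivity of the `Q × S` coordinates `z_{(q,s)} = inl (inr (q,s))`. [folklore] -/
theorem yS_inj (j l : Q) (t t' : S) :
    (Sum.inl (Sum.inr (j, t)) : DPIdx P Q R S) = Sum.inl (Sum.inr (l, t')) ↔ j = l ∧ t = t' := by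
  simp only [Sum.inl.injEq, Sum.inr.injEq, Prod.mk.injEq]

/-- the `P × S` and `Q × S` coordinates are distinct. [folklore] -/
theorem xS_ne_yS (i : P) (j : Q) (t t' : S) : (Sum.inr (Sum.inl (i, t)) : DPIdx P Q R S) ≠ Sum.inl (Sum.inr (j, t')) :=
  Sum.inr_ne_inl

/-- the `S`-plane derivatives kill the `R`-contractions: `∂_{(p,s)} C^R_{kl} = 0`. [folklore] -/
theorem pderiv_xS_contrR [Fintype R] (p : P) (s : S) (k : P) (l : Q) :
    pderiv (Sum.inr (Sum.inl (p, s)) : DPIdx P Q R S)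
      (∑ r : R, X (Sum.inl (Sum.inl (k, r))) * X (Sum.inr (Sum.inr (l, r))) : MvPolynomial (DPIdx P Q R S) ℂ) = 0 := by
  rw [map_sum]
  exact Finset.sum_eq_zero fun r _ => by
    rw [pderiv_mul, pderiv_X_of_ne (by simp), pderiv_X_of_ne (by simp), zero_mul, mul_zero, add_zero]

/-- `∂_{(q,s)} C^R_{kl} = 0`. [folklore] -/
theorem pderiv_yS_contrR [Fintype R] (q : Q) (s : S) (k : P) (l : Q) :
    pderiv (Sum.inl (Sum.inr (q, s)) : DPIdx P Q R S)
      (∑ r : R, X (Sum.inl (Sum.inl (k, r))) * X (Sum.inr (Sum.inr (l, r))) : MvPolynomial (DPIdx P Q R S) ℂ) = 0 := by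
  rw [map_sum]
  exact Finset.sum_eq_zero fun r _ => by
    rw [pderiv_mul, pderiv_X_of_ne (by simp), pderiv_X_of_ne (by simp), zero_mul, mul_zero, add_zero]

/-- the `R`-plane derivatives kill the `S`-contractions: `∂_{(p,r)} C^S_{kl} = 0`. [folklore] -/
theorem pderiv_xR_contrS [Fintype S] (p : P) (r : R) (k : P) (l : Q) :
    pderiv (Sum.inl (Sum.inl (p, r)) : DPIdx P Q R S)
      (∑ s : S, X (Sum.inr (Sum.inl (k, s))) * X (Sum.inl (Sum.inr (l, s))) : MvPolynomial (DPIdx P Q R S) ℂ) = 0 := by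
  rw [map_sum]
  exact Finset.sum_eq_zero fun s _ => by
    rw [pderiv_mul, pderiv_X_of_ne (by simp), pderiv_X_of_ne (by simp), zero_mul, mul_zero, add_zero]

/-- `∂_{(q,r)} C^S_{kl} = 0`. [folklore] -/
theorem pderiv_yR_contrS [Fintype S] (q : Q) (r : R) (k : P) (l : Q) :
    pderiv (Sum.inr (Sum.inr (q, r)) : DPIdx P Q R S)
      (∑ s : S, X (Sum.inr (Sum.inl (k, s))) * X (Sum.inl (Sum.inr (l, s))) : MvPolynomial (DPIdx P Q R S) ℂ) = 0 := by
  rw [map_sum]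
  exact Finset.sum_eq_zero fun s _ => by
    rw [pderiv_mul, pderiv_X_of_ne (by simp), pderiv_X_of_ne (by simp), zero_mul, mul_zero, add_zero]

/-- **`D^S` passes through `C^R`**: `D^S_{ij}(C^R_{kl}·F) = C^R_{kl}·D^S_{ij}F`. [cite: KashiwaraVergne1978, §II.5] -/
theorem lapS_contrR_mul [Fintype R] [Fintype S] (i : P) (j : Q) (k : P) (l : Q) (F : MvPolynomial (DPIdx P Q R S) ℂ) :
    ∑ s : S, pderiv (Sum.inr (Sum.inl (i, s))) (pderiv (Sum.inl (Sum.inr (j, s)))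
        ((∑ r : R, X (Sum.inl (Sum.inl (k, r))) * X (Sum.inr (Sum.inr (l, r)))) * F)) =
      (∑ r : R, X (Sum.inl (Sum.inl (k, r))) * X (Sum.inr (Sum.inr (l, r)))) *
        ∑ s : S, pderiv (Sum.inr (Sum.inl (i, s))) (pderiv (Sum.inl (Sum.inr (j, s))) F) :=
  lap_mul_of_const (fun p s => (Sum.inr (Sum.inl (p, s)) : DPIdx P Q R S)) (fun q s => Sum.inl (Sum.inr (q, s))) i j
    (fun s => pderiv_xS_contrR R S i s k l) (fun s => pderiv_yS_contrR R S j s k l) F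

/-- **`D^R` passes through `C^S`**: `D^R_{ij}(C^S_{kl}·F) = C^S_{kl}·D^R_{ij}F`. [cite: KashiwaraVergne1978, §II.5] -/
theorem lapR_contrS_mul [Fintype R] [Fintype S] (i : P) (j : Q) (k : P) (l : Q) (F : MvPolynomial (DPIdx P Q R S) ℂ) :
    ∑ r : R, pderiv (Sum.inl (Sum.inl (i, r))) (pderiv (Sum.inr (Sum.inr (j, r)))
        ((∑ s : S, X (Sum.inr (Sum.inl (k, s))) * X (Sum.inl (Sum.inr (l, s)))) * F)) =
      (∑ s : S, X (Sum.inr (Sum.inl (k, s))) * X (Sum.inl (Sum.inr (l, s)))) *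
        ∑ r : R, pderiv (Sum.inl (Sum.inl (i, r))) (pderiv (Sum.inr (Sum.inr (j, r))) F) :=
  lap_mul_of_const (fun p r => (Sum.inl (Sum.inl (p, r)) : DPIdx P Q R S)) (fun q r => Sum.inr (Sum.inr (q, r))) i j
    (fun r => pderiv_xR_contrS R S i r k l) (fun r => pderiv_yR_contrS R S j r k l) F

/-- **`[D^S, C^S]` in `DPIdx` coordinates** (§1 `lap_contr_mul` at the `S`-plane embeddings):
`D^S_{ij}(C^S_{kl}·F) = C^S_{kl}·D^S_{ij}F + [j = l]·E^{P,S}_{ki}F + [i = k]·E^{Q,S}_{lj}F + [i = k ∧ j = l]·|S|·F`. [cite: KashiwaraVergne1978, §II.5] -/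
theorem lapS_contrS_mul [Fintype S] [DecidableEq P] [DecidableEq Q] [DecidableEq R] [DecidableEq S] (i : P) (j : Q) (k : P) (l : Q)
    (F : MvPolynomial (DPIdx P Q R S) ℂ) :
    ∑ s : S, pderiv (Sum.inr (Sum.inl (i, s))) (pderiv (Sum.inl (Sum.inr (j, s)))
        ((∑ s' : S, X (Sum.inr (Sum.inl (k, s'))) * X (Sum.inl (Sum.inr (l, s')))) * F)) =
      (∑ s' : S, X (Sum.inr (Sum.inl (k, s'))) * X (Sum.inl (Sum.inr (l, s')))) *
          (∑ s : S, pderiv (Sum.inr (Sum.inl (i, s))) (pderiv (Sum.inl (Sum.inr (j, s))) F)) +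
        (if j = l then ∑ s : S, X (Sum.inr (Sum.inl (k, s))) * pderiv (Sum.inr (Sum.inl (i, s))) F else 0) +
        (if i = k then ∑ s : S, X (Sum.inl (Sum.inr (l, s))) * pderiv (Sum.inl (Sum.inr (j, s))) F else 0) +
          (if i = k ∧ j = l then (Fintype.card S : ℂ) • F else 0) :=
  lap_contr_mul (fun p s => (Sum.inr (Sum.inl (p, s)) : DPIdx P Q R S)) (fun q s => Sum.inl (Sum.inr (q, s)))
    (fun i k t t' => xS_inj R S i k t t') (fun j l t t' => yS_inj R S j l t t') (fun i j t t' => xS_ne_yS R S i j t t') i j k l F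

/-- **`[D^R, C^R]` in `DPIdx` coordinates** (§1 `lap_contr_mul` at the `R`-plane embeddings). [cite: KashiwaraVergne1978, §II.5] -/
theorem lapR_contrR_mul [Fintype R] [DecidableEq P] [DecidableEq Q] [DecidableEq R] [DecidableEq S] (i : P) (j : Q) (k : P) (l : Q)
    (F : MvPolynomial (DPIdx P Q R S) ℂ) :
    ∑ r : R, pderiv (Sum.inl (Sum.inl (i, r))) (pderiv (Sum.inr (Sum.inr (j, r)))
        ((∑ r' : R, X (Sum.inl (Sum.inl (k, r'))) * X (Sum.inr (Sum.inr (l, r')))) * F)) =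
      (∑ r' : R, X (Sum.inl (Sum.inl (k, r'))) * X (Sum.inr (Sum.inr (l, r')))) *
          (∑ r : R, pderiv (Sum.inl (Sum.inl (i, r))) (pderiv (Sum.inr (Sum.inr (j, r))) F)) +
        (if j = l then ∑ r : R, X (Sum.inl (Sum.inl (k, r))) * pderiv (Sum.inl (Sum.inl (i, r))) F else 0) +
        (if i = k then ∑ r : R, X (Sum.inr (Sum.inr (l, r))) * pderiv (Sum.inr (Sum.inr (j, r))) F else 0) +
          (if i = k ∧ j = l then (Fintype.card R : ℂ) • F else 0) :=
  lap_contr_mul (fun p r => (Sum.inl (Sum.inl (p, r)) : DPIdx P Q R S)) (fun q r => Sum.inr (Sum.inr (q, r)))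
    (fun i k t t' => xR_inj R S i k t t') (fun j l t t' => yR_inj R S j l t t') (fun i j t t' => xR_ne_yR R S i j t t') i j k l F

/-- the contraction as ONE multiplier: `Σ_t z_{(k,t)}·(z_{(l,t)}·F) = (Σ_t z_{(k,t)} z_{(l,t)})·F`. [folklore] -/
theorem sum_X_mul_X_mul {σ ι : Type*} (s : Finset ι) (u v : ι → σ) (F : MvPolynomial σ ℂ) :
    ∑ t ∈ s, X (u t) * (X (v t) * F) = (∑ t ∈ s, X (u t) * X (v t)) * F := by
  rw [Finset.sum_mul]
  exact Finset.sum_congr rfl fun t _ => (mul_assoc _ _ _).symm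

section Bridge

variable [Fintype P] [DecidableEq P] [Fintype Q] [DecidableEq Q] [Fintype R] [DecidableEq R] [Fintype S] [DecidableEq S] (p₀ : P) (q₀ : Q)

/-- **THE BRIDGE, `𝔭⁺`**: `𝔭⁺_{(p₀,q₀)}(B⁻¹F) = B⁻¹((2i∕π)·D^S_{p₀q₀}F − 2πi·C^R_{p₀q₀}·F)` — ★ `hypOpGen_sub_I_smul_rotBoostGen_binvPi` with the `R`-contraction
as one multiplier. [cite: Folland1989, §4.2 Prop. (4.39)] [cite: KashiwaraVergne1978, §II.5] -/
theorem pPlus_binvPi (F : MvPolynomial (DPIdx P Q R S) ℂ) :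
    hypOpGen R S p₀ q₀ (binvPi F) - I • rotBoostGen R S p₀ q₀ (π / 2) (binvPi F) =
      binvPi ((2 * (π : ℂ)⁻¹ * I : ℂ) • ∑ s : S, pderiv (Sum.inr (Sum.inl (p₀, s))) (pderiv (Sum.inl (Sum.inr (q₀, s))) F) -
        (2 * π * I : ℂ) • ((∑ r : R, X (Sum.inl (Sum.inl (p₀, r))) * X (Sum.inr (Sum.inr (q₀, r)))) * F)) := by
  rw [hypOpGen_sub_I_smul_rotBoostGen_binvPi, sum_X_mul_X_mul]

/-- **THE BRIDGE, `𝔭⁻`**: `𝔭⁻_{(p₀,q₀)}(B⁻¹F) = B⁻¹(2πi·C^S_{p₀q₀}·F − (2i∕π)·D^R_{p₀q₀}F)` — ★ `hypOpGen_add_I_smul_rotBoostGen_binvPi` with the `S`-contraction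
as one multiplier. [cite: Folland1989, §4.2 Prop. (4.39)] [cite: KashiwaraVergne1978, §II.5] -/
theorem pMinus_binvPi (F : MvPolynomial (DPIdx P Q R S) ℂ) :
    hypOpGen R S p₀ q₀ (binvPi F) + I • rotBoostGen R S p₀ q₀ (π / 2) (binvPi F) =
      binvPi ((2 * π * I : ℂ) • ((∑ s : S, X (Sum.inr (Sum.inl (p₀, s))) * X (Sum.inl (Sum.inr (q₀, s)))) * F) -
        (2 * (π : ℂ)⁻¹ * I : ℂ) • ∑ r : R, pderiv (Sum.inl (Sum.inl (p₀, r))) (pderiv (Sum.inr (Sum.inr (q₀, r))) F)) := by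
  rw [hypOpGen_add_I_smul_rotBoostGen_binvPi, sum_X_mul_X_mul]

/-- **`𝔭⁺` ON THE VACUUM POLYNOMIAL**: `𝔭⁺_{(p₀,q₀)}(B⁻¹1) = B⁻¹(−2πi·C^R_{p₀q₀})` (pure creation on the `R`-planes; `D^S·1 = 0`).
[cite: Folland1989, §4.2 Prop. (4.39)] -/
theorem pPlus_binvPi_one :
    hypOpGen R S p₀ q₀ (binvPi (1 : MvPolynomial (DPIdx P Q R S) ℂ)) - I • rotBoostGen R S p₀ q₀ (π / 2) (binvPi 1) =
      binvPi (-((2 * π * I : ℂ) • ∑ r : R, X (Sum.inl (Sum.inl (p₀, r))) * X (Sum.inr (Sum.inr (q₀, r))))) := by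
  rw [pPlus_binvPi, mul_one,
    lap_one (fun p s => (Sum.inr (Sum.inl (p, s)) : DPIdx P Q R S)) (fun q s => Sum.inl (Sum.inr (q, s))) p₀ q₀, smul_zero, zero_sub]

/-- **`𝔭⁻` ON THE VACUUM POLYNOMIAL**: `𝔭⁻_{(p₀,q₀)}(B⁻¹1) = B⁻¹(2πi·C^S_{p₀q₀})` (pure creation on the `S`-planes; `D^R·1 = 0`).
[cite: Folland1989, §4.2 Prop. (4.39)] -/
theorem pMinus_binvPi_one :
    hypOpGen R S p₀ q₀ (binvPi (1 : MvPolynomial (DPIdx P Q R S) ℂ)) + I • rotBoostGen R S p₀ q₀ (π / 2) (binvPi 1) =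
      binvPi ((2 * π * I : ℂ) • ∑ s : S, X (Sum.inr (Sum.inl (p₀, s))) * X (Sum.inl (Sum.inr (q₀, s)))) := by
  rw [pMinus_binvPi, mul_one,
    lap_one (fun p r => (Sum.inl (Sum.inl (p, r)) : DPIdx P Q R S)) (fun q r => Sum.inr (Sum.inr (q, r))) p₀ q₀, smul_zero, sub_zero]

end Bridge

end Junction

end Summit.HodgeConjecture.HodgeConjecture.Cruxes.HLiu418.K2LiuFockPActionLetters

end
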